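import Literature.NumberTheory.LFunctions.WeilFirstPrimeCertificateDataC
import HarnessLib

/-!
# First-prime Weil positivity, stage C: kernel check of the even scaled moments ν_0, ν_2, ν_4, ν_6, ν_8, ν_10

Part of `weilCert3C.check` (`WeilFirstPrimeCertificateDataC.lean`), evaluated by `decide +kernel` and kept in its own
file for kernel time and memory (each declaration is checked separately). Assembled in
`WeilFirstPrimeCertificateCCheck.lean`. Pure proof file; nothing is asserted.
-/

noncomputable section

namespace Literature.NumberTheory.LFunctions

set_option maxHeartbeats 0 in
/-- **Kernel check of the scaled moment `ν_{0}`** of the stage-C first-prime certificate. [folklore] -/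
theorem checkNuAt0_weilCert3C : weilCert3C.checkNuAt 0 = true := by
  decide +kernel

set_option maxHeartbeats 0 in
/-- **Kernel check of the scaled moment `ν_{2}`** of the stage-C first-prime certificate. [folklore] -/
theorem checkNuAt2_weilCert3C : weilCert3C.checkNuAt 2 = true := by
  decide +kernel

set_option maxHeartbeats 0 in
/-- **Kernel check of the scaled moment `ν_{4}`** of the stage-C first-prime certificate. [folklore] -/
theorem checkNuAt4_weilCert3C : weilCert3C.checkNuAt 4 = true := by
  decide +kernel

set_option maxHeartbeats 0 in
/-- **Kernel check of the scaled moment `ν_{6}`** of the stage-C first-prime certificate. [folklore] -/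
theorem checkNuAt6_weilCert3C : weilCert3C.checkNuAt 6 = true := by
  decide +kernel

set_option maxHeartbeats 0 in
/-- **Kernel check of the scaled moment `ν_{8}`** of the stage-C first-prime certificate. [folklore] -/
theorem checkNuAt8_weilCert3C : weilCert3C.checkNuAt 8 = true := by
  decide +kernel

set_option maxHeartbeats 0 in
/-- **Kernel check of the scaled moment `ν_{10}`** of the stage-C first-prime certificate. [folklore] -/
theorem checkNuAt10_weilCert3C : weilCert3C.checkNuAt 10 = true := by
  decide +kernel

end Literature.NumberTheory.LFunctions
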